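import Mathlib
import Summits.Ventures.HodgeRepro2.T5HeckeInducedIrreducible
import Summits.Ventures.HodgeRepro2.T5HeckeCommutativeMultiplicityOne

/-!
# EVERY CHARACTER OF A COMMUTATIVE HECKE ALGEBRA IS THE HECKE CHARACTER OF AN IRREDUCIBLE SPHERICAL REPRESENTATION

Tier-5 support N3 / §G-N4.2 (seat p3, gen 84). Seat p8's `T5HeckeInducedIrreducible` makes every simple
`H(G, K)`-module `M` the `K`-invariants of an irreducible `K`-finite representation `quotRep k K M hfin`
(`isIrreducible_and_kFinite_and_equiv`); seat p8's `T5HeckeCommutativeMultiplicityOne` attaches to an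
irreducible `K`-finite `ρ` with commutative `H(G, K)` and non-zero finite-dimensional `ρ^K` its Hecke character
`heckeCharacter ρ … : H(G, K) → k`. This file feeds the ONE-DIMENSIONAL module `k_χ` of a character
`χ : H(G, K) →ₐ[k] k` into p8's construction:

* **`charModule χ`** — the `H(G, K)ᵐᵒᵖ`-module structure `op T • m = χ T · m` on `k` (`Module.compHom` through
  `RingHom.fromOpposite`), **`charScalarTower χ`** — it is a `k`-scalar tower;
* **`isSimpleOrder_submodule_charModule`** — `k_χ` is a simple `H(G, K)ᵐᵒᵖ`-module (a non-zero submodule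
  contains `1`, the scalars acting through `χ ∘ algebraMap`);
* **`isIrreducible_quotRep_char`**, **`kFinite_quotRep_char`**, **`invariants_quotRep_char_ne_bot`**,
  **`finiteDimensional_invariants_quotRep_char`** — the representation `π_χ := quotRep k K k_χ hfin` is
  irreducible, `K`-finite, with non-zero finite-dimensional (one-dimensional) `K`-invariants;
* **`heckeCharacter_quotRep_char`** — THE HECKE CHARACTER OF `π_χ` IS `χ`: `heckeCharacter π_χ … T = χ T` for
  every `T ∈ H(G, K)` (p8's `heckeCharacter_eq_of_smul_eq` on the vector `e 1`, `e = quotInvariantsEquiv`).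

So, for a commutative `H(G, K)` over an algebraically closed `k` of characteristic `0`, the map
`π ↦ heckeCharacter π` from irreducible `K`-finite representations with non-zero finite-dimensional `π^K`
to the characters of `H(G, K)` is ONTO (this file) and INJECTIVE on isomorphism classes (p8's
`nonempty_equiv_iff_heckeCharacterAlgHom_eq`). The inert local package of the record (where `H = k[T₁]` and
the characters are the values at `T₁`) is the next file's.

Nothing here is a statement about (P), theta lifts or L-values. §8(d): uses an L-value-free non-vanishing
device: NO.
-/

open Summit.Ventures.HodgeRepro2.T5HeckePermutationModule Summit.Ventures.HodgeRepro2.T5HeckeInducedIrreducible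
  Summit.Ventures.HodgeRepro2.T5HeckeCommutativeMultiplicityOne Summit.Ventures.HodgeRepro2.T5LevelIdempotent
  Summit.Ventures.HodgeRepro2.LevelPositivity

namespace Summit.Ventures.HodgeRepro2.T5HeckeCharacterRepresentation

variable {G : Type*} [Group G] (k : Type*) [Field k] (K : Subgroup G)

section CharModule

variable (χ : heckeAlgebra k K →ₐ[k] k)

/-- **The one-dimensional module `k_χ`**: `H(G, K)ᵐᵒᵖ` acts on `k` by `op T • m = χ T * m`
(`Module.compHom` through `RingHom.fromOpposite`; `k` is commutative). -/
@[reducible] noncomputable def charModule : Module (heckeAlgebra k K)ᵐᵒᵖ k :=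
  Module.compHom k (χ.toRingHom.fromOpposite fun x y => Commute.all (χ x) (χ y))

/-- `op T • m = χ T * m` in `k_χ`. -/
theorem charModule_smul_def (T : heckeAlgebra k K) (m : k) :
    letI := charModule k K χ
    MulOpposite.op T • m = χ T * m := rfl

/-- **`k_χ` is a `k`-scalar tower**: `(c • op T) • m = c • (op T • m)`. -/
theorem charScalarTower :
    letI := charModule k K χ
    IsScalarTower k (heckeAlgebra k K)ᵐᵒᵖ k := by
  letI := charModule k K χ
  refine ⟨fun c T m => ?_⟩
  induction T using MulOpposite.rec' with
  | h T =>
    rw [← MulOpposite.op_smul, charModule_smul_def, charModule_smul_def, map_smul, smul_eq_mul, smul_eq_mul,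
      mul_assoc]

/-- **`k_χ` is a simple `H(G, K)ᵐᵒᵖ`-module**: a non-zero submodule contains `1` (the scalars of `k` act
through `χ ∘ algebraMap = id`), hence is everything. -/
theorem isSimpleOrder_submodule_charModule :
    letI := charModule k K χ
    IsSimpleOrder (Submodule (heckeAlgebra k K)ᵐᵒᵖ k) := by
  letI := charModule k K χ
  have hscal : ∀ (c : k) (m : k), MulOpposite.op (algebraMap k (heckeAlgebra k K) c) • m = c * m := by
    intro c m
    rw [charModule_smul_def, AlgHom.commutes]
    rfl
  refine { exists_pair_ne := ⟨⊥, ⊤, ?_⟩, eq_bot_or_eq_top := fun N => ?_ }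
  · intro h
    have : (1 : k) ∈ (⊥ : Submodule (heckeAlgebra k K)ᵐᵒᵖ k) := by rw [h]; exact Submodule.mem_top
    exact one_ne_zero ((Submodule.mem_bot _).mp this)
  · by_cases hN : N = ⊥
    · exact Or.inl hN
    · right
      obtain ⟨x, hxN, hx0⟩ := (Submodule.ne_bot_iff N).mp hN
      rw [Submodule.eq_top_iff']
      intro y
      have : y = MulOpposite.op (algebraMap k (heckeAlgebra k K) (y * x⁻¹)) • x := by
        rw [hscal, mul_assoc, inv_mul_cancel₀ hx0, mul_one]
      rw [this]
      exact N.smul_mem _ hxN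

end CharModule

section Representation

variable (hfin : ∀ g : G, Finite (MulAction.orbit K (g : G ⧸ K))) [CharZero k]
variable (χ : heckeAlgebra k K →ₐ[k] k)

/-- **`π_χ` is irreducible** (p8's `isIrreducible_quotRep` on the simple module `k_χ`). -/
theorem isIrreducible_quotRep_char :
    letI := charModule k K χ
    letI := charScalarTower k K χ
    (quotRep k K k hfin).IsIrreducible := by
  letI := charModule k K χ
  letI := charScalarTower k K χ
  haveI := isSimpleOrder_submodule_charModule k K χ
  exact isIrreducible_quotRep k K k hfin

/-- **`π_χ` is `K`-finite** (p8's `kFinite_quotRep`). -/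
theorem kFinite_quotRep_char :
    letI := charModule k K χ
    KFinite (quotRep k K k hfin) K := by
  letI := charModule k K χ
  exact kFinite_quotRep k K k hfin

/-- **`π_χ^K ≠ 0`**: the image of `1 ∈ k_χ` under p8's `quotInvariantsEquiv`. -/
theorem invariants_quotRep_char_ne_bot :
    letI := charModule k K χ
    letI := charScalarTower k K χ
    invariants (quotRep k K k hfin) K ≠ ⊥ := by
  letI := charModule k K χ
  letI := charScalarTower k K χ
  rw [Submodule.ne_bot_iff]
  refine ⟨(quotInvariantsEquiv k K k hfin 1 : _), (quotInvariantsEquiv k K k hfin 1).2, ?_⟩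
  intro h
  have h1 : quotInvariantsEquiv k K k hfin 1 = 0 := Subtype.ext h
  rw [map_eq_zero_iff _ (quotInvariantsEquiv k K k hfin).injective] at h1
  exact one_ne_zero h1

/-- **`π_χ^K` is finite-dimensional** (it is `k_χ`, one-dimensional). -/
theorem finiteDimensional_invariants_quotRep_char :
    letI := charModule k K χ
    letI := charScalarTower k K χ
    FiniteDimensional k (invariants (quotRep k K k hfin) K) := by
  letI := charModule k K χ
  letI := charScalarTower k K χ
  exact LinearEquiv.finiteDimensional (quotInvariantsEquiv k K k hfin)

variable [IsAlgClosed k]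

/-- **THE HECKE CHARACTER OF `π_χ` IS `χ`**: for every `T ∈ H(G, K)`, `heckeCharacter π_χ … T = χ T`
(p8's `heckeSMul_quotInvariantsEquiv`: `T` acts on `e 1` by `e (op T • 1) = χ T • e 1`, and
`heckeCharacter_eq_of_smul_eq`). -/
theorem heckeCharacter_quotRep_char (hcomm : ∀ T S : heckeAlgebra k K, T * S = S * T) (T : heckeAlgebra k K) :
    letI := charModule k K χ
    letI := charScalarTower k K χ
    haveI := isIrreducible_quotRep_char k K hfin χ
    haveI := finiteDimensional_invariants_quotRep_char k K hfin χ
    heckeCharacter (quotRep k K k hfin) (kFinite_quotRep_char k K hfin χ) hfin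
      (invariants_quotRep_char_ne_bot k K hfin χ) hcomm T = χ T := by
  letI := charModule k K χ
  letI := charScalarTower k K χ
  haveI := isIrreducible_quotRep_char k K hfin χ
  haveI := finiteDimensional_invariants_quotRep_char k K hfin χ
  apply heckeCharacter_eq_of_smul_eq (quotRep k K k hfin) (kFinite_quotRep_char k K hfin χ) hfin
    (invariants_quotRep_char_ne_bot k K hfin χ) hcomm (v := quotInvariantsEquiv k K k hfin 1)
  · intro h
    rw [map_eq_zero_iff _ (quotInvariantsEquiv k K k hfin).injective] at h
    exact one_ne_zero h
  · rw [heckeSMul_quotInvariantsEquiv, charModule_smul_def, mul_one]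
    conv_lhs => rw [← mul_one (χ T), ← smul_eq_mul]
    rw [LinearEquiv.map_smul]

end Representation

end Summit.Ventures.HodgeRepro2.T5HeckeCharacterRepresentation
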